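/-
Copyright (c) 2026. All rights reserved.
Released under Apache 2.0 license as described in the file LICENSE.
Authors: abc-iut cell, prover seat abc-iut-L4-t15 (gen 10).
-/
import Mathlib.FieldTheory.IsAlgClosed.AlgebraicClosure
import Mathlib.GroupTheory.SemidirectProduct
import Literature.IUT.HodgeTheaters.PuncturedEllipticGeomOrigin
import Literature.IUT.HodgeTheaters.ProfiniteCompletionFiniteIndexKernel
import HarnessLib

/-!
# [IUTchI] §1: the geometric ORIGIN RECORD `PuncturedEllipticData.GeomOrigin` is INHABITED at an explicit
# PROFINITE datum — the profinite completion of the orbifold group `F₂ ⋊ ℤ/2` of the `(1,1)_±` orbicurve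

Mochizuki, *Inter-universal Teichmüller theory I*, §1 p. 37 ("`X` a hyperbolic curve of type `(1,1)` … `C` a
hyperbolic orbicurve of type `(1,1)_±` … the quotient of `X` by the unique `k`-involution `−1`")
[cite: Mochizuki2012, IUTchI §1 p.37] (D-0012 claim key; nothing of the disputed series is asserted here);
A. Grothendieck, SGA 1 Exp. XIII Cor. 2.12 (`π₁` of a once-punctured elliptic curve over an algebraically closed
field of characteristic `0` is free profinite on two generators); S. Mochizuki, *Topics in Absolute Anabelian
Geometry I*, Lemma 4.5 (i) p. 54 ("free pro-`Σ`", the tree's `IsFreeProOn`) [cite: MochizukiAbsTopI2012,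
Lemma 4.5 (i) p.54].

PROOF-ONLY file (0 definitions, 0 named facts; cell abc-iut, seat abc-iut-L4-t15 gen 10, L5 ROWS #7 row R47
«GEOMORIGIN-NV@PROFINITE» — the PROFINITE half of the [IUTchI] Cor. 1.2 non-vacuity pair; the pro-`l` half is
abc-iut-L5-d4's COR12-NV-PROL, where `IsFreeProOn` fails by design).  abc-iut-L5-t1's record
`PuncturedEllipticData.GeomOrigin D` (p495678: (A) `Δ_X` free profinite on two generators, (c′) every cusp
inertia group a `Δ_X`-conjugate of `⟨[a,b]⟩⁻`, (e) `Δ_C` topologically generated by torsion) is a HYPOTHESIS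
record asserted for no datum.  This file builds ONE datum `D₀ : PuncturedEllipticData` and a record
`O₀ : D₀.GeomOrigin` from profinite group theory alone:

* §1 (companion file `ProfiniteCompletionFiniteIndexKernel.lean`, same seat) plumbing in `Ŵ = profiniteCompletion W`
  (any group `W`): `ProfiniteCompletion.exists_open_subgroup_of_finiteIndex` — a
  finite-index normal `M ⊴ W` gives an OPEN subgroup `K ≤ Ŵ` of the same index with `η⁻¹(K) = M` (the kernel of
  `Ŵ ↠ W/M`); `le_closure_image_of_open` — such a `K` lies in the closure of `η(M)`;
  **`isProSigmaCompletion_codRestrict`** — for an injective `i : F ↪ W` with image `M`, the corestriction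
  `F → K`, `x ↦ η(i x)` is a pro-`𝔓𝔯𝔦𝔪𝔢𝔰` completion (abc-iut-L3's `IsProSigmaCompletion`: dense image; open normal
  subgroups of the compact `K` have finite index; a finite-index normal `N ⊴ F` is cut out through
  `Ŵ ↠ W/core_W(i(N))`); hence **`isFreeProOn_codRestrict`** — for `F = F_n` free, `K` is free pro-`𝔓𝔯𝔦𝔪𝔢𝔰` on
  the letters (abc-iut-L4-t15's bridge `isFreeProOn_of_isProSigmaCompletion_lift`, p424814), and
  `isFreeProOn_univ_of_prime` (the record's index set `Set.univ` singles out the same finite groups).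
* §2 the orbifold group `W = F₂ ⋊[φ] ℤ/2`: `exists_inversionAction` (`φ(σ)`: `a ↦ a⁻¹`, `b ↦ b⁻¹` — the action
  of the elliptic involution on `π₁` of a once-punctured torus based at a `2`-torsion point),
  `index_range_inl` (`[W : F₂] = 2`), `normal_range_inl`, `closure_three_eq_top` (`W = ⟨σ, aσ, bσ⟩`),
  `isOfFinOrder_three` (`σ² = (aσ)² = (bσ)² = 1`; remark, not used: `W ≅ ℤ/2 ∗ ℤ/2 ∗ ℤ/2`, the `(2,2,2,∞)`
  orbifold group, whose torsion-free index-`2` subgroup is `F₂`).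
* §3 **`PuncturedEllipticData.exists_nonempty_geomOrigin`** — THE DATUM `D₀`: `Π_C := Ŵ` over an algebraically
  closed base (`G_k := Gal(ℚ̄/ℚ̄)`, a subsingleton, so `Π_C = Δ_C`); `Π_X := Ker(Ŵ ↠ W/F₂ ≅ ℤ/2)` (open, index
  `2`, `= Δ_X`); `Π_C̲ := Π_C`; `l := 5`; assumption (∗) holds because `G_k = 1` (the commutator lies in
  `⁅Δ_X, Δ_X⁆`); four cusp labels `ε⁰, ε′, ε″, 2ε`, each with decomposition = inertia group `⟨η[a,b]⟩⁻ ≤ Π_X`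
  (representatives of the single conjugacy class of cusps of `X`; the interface allows any representatives).
  THE RECORD `O₀`: `gens = (η a, η b)` regarded in `Π_X ∩ Δ_C`; (A) by `isFreeProOn_codRestrict`; (c′) with
  `g = 1`; (e) `Δ_C = Ŵ` is the closure of `η(W)` (density) and `η(W)` is generated by the images of the three
  involutions.  Also recorded: `Subsingleton D₀.E.gal`, `[Π_C : Π_X] = 2`, and `Π_C ≃ₜ* Ŵ` (the identity).

* (v2) `PuncturedEllipticData.exists_nonempty_geomOrigin_rational` — additionally cusp rationality (r): every `D_x`
  surjects onto `G_k` (abc-iut-L5-t1's `hrat`, p500241), trivial at `D₀`.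

HONEST LABEL: a group-theoretic model — the profinite completion of the TOPOLOGICAL orbifold fundamental group
of `C = X/{±1}` over an algebraically closed base — not the étale `π₁` of a `k`-scheme (none is constructed in
the tree); it shows that the record type `GeomOrigin` is consistent with the interface `PuncturedEllipticData`
at a datum whose `Δ_X` is genuinely `F̂₂`, nothing more.  Nothing here bears on [IUTchIII] Cor. 3.12 or asserts
that abc is proved or refuted; inhabited ≠ endorsed; no side taken.
-/

noncomputable section

open CategoryTheory Topology ProfiniteGrp

namespace Literature.IUT.HodgeTheaters

namespace GeomOriginProfiniteModel

open Literature.AnabelianGeometry.AbsoluteAnabelian Literature.IUT.HodgeTheaters.ProfiniteCompletion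

/-! ### §2. The orbifold group `W = F₂ ⋊ ℤ/2` of the `(1,1)_±` orbicurve: the inversion action, generation
by three involutions, index of `F₂` -/

/-- **The inversion-on-letters action of `ℤ/2` on `F₂`**: a homomorphism `φ : ℤ/2 → Aut(F₂)` whose generator
sends each free letter to its inverse (the elliptic involution `−1` of a once-punctured elliptic curve acts on
`π₁ = ⟨a, b⟩` by `a ↦ a⁻¹`, `b ↦ b⁻¹` for a base point at a `2`-torsion point). [cite: Mochizuki2012, IUTchI §1 p.37] -/
theorem exists_inversionAction : ∃ φ : Multiplicative (ZMod 2) →* MulAut (FreeGroup (Fin 2)),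
    ∀ a : Fin 2, φ (Multiplicative.ofAdd 1) (FreeGroup.of a) = (FreeGroup.of a)⁻¹ := by
  let f : FreeGroup (Fin 2) →* FreeGroup (Fin 2) := FreeGroup.lift fun a => (FreeGroup.of a)⁻¹
  have hff : f.comp f = MonoidHom.id _ := by
    ext a
    simp [f]
  let ι : MulAut (FreeGroup (Fin 2)) := MonoidHom.toMulEquiv f f hff hff
  have hιι : ι * ι = 1 := by
    ext x
    change f (f x) = x
    exact DFunLike.congr_fun hff x
  have hcases : ∀ g : Multiplicative (ZMod 2), g = 1 ∨ g = Multiplicative.ofAdd 1 := by decide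
  have hne : (Multiplicative.ofAdd (1 : ZMod 2)) ≠ 1 := by decide
  have h11 : Multiplicative.ofAdd (1 : ZMod 2) * Multiplicative.ofAdd (1 : ZMod 2) = 1 := by decide
  refine ⟨MonoidHom.mk' (fun g => if g = 1 then 1 else ι) ?_, fun a => ?_⟩
  · intro g h
    rcases hcases g with rfl | rfl <;> rcases hcases h with rfl | rfl
    · simp
    · simp
    · simp
    · simp only [h11, hne, if_false, if_true]
      exact hιι.symm
  · have : (MonoidHom.mk' (fun g : Multiplicative (ZMod 2) => if g = 1 then (1 : MulAut (FreeGroup (Fin 2))) else ι)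
        (by
          intro g h
          rcases hcases g with rfl | rfl <;> rcases hcases h with rfl | rfl
          · simp
          · simp
          · simp
          · simp only [h11, hne, if_false, if_true]
            exact hιι.symm)) (Multiplicative.ofAdd 1) = ι := by
      simp [hne]
    rw [this]
    change f (FreeGroup.of a) = (FreeGroup.of a)⁻¹
    simp [f]

section Orbifold

variable (φ : Multiplicative (ZMod 2) →* MulAut (FreeGroup (Fin 2)))

/-- `[F₂ ⋊ ℤ/2 : F₂] = 2`. [cite: Mochizuki2012, IUTchI §1 p.37] -/
theorem index_range_inl :
    (SemidirectProduct.inl : FreeGroup (Fin 2) →* FreeGroup (Fin 2) ⋊[φ] Multiplicative (ZMod 2)).range.index = 2 := by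
  rw [SemidirectProduct.range_inl_eq_ker_rightHom, Subgroup.index_ker,
    MonoidHom.range_eq_top.mpr SemidirectProduct.rightHom_surjective, Subgroup.card_top]
  simp [Nat.card_eq_fintype_card]

/-- `F₂ ⊴ F₂ ⋊ ℤ/2`. [cite: Mochizuki2012, IUTchI §1 p.37] -/
theorem normal_range_inl :
    (SemidirectProduct.inl : FreeGroup (Fin 2) →* FreeGroup (Fin 2) ⋊[φ] Multiplicative (ZMod 2)).range.Normal := by
  rw [SemidirectProduct.range_inl_eq_ker_rightHom]
  infer_instance

/-- **`W = F₂ ⋊ ℤ/2` is generated by `σ, a·σ, b·σ`.** [cite: Mochizuki2012, IUTchI §1 p.37] -/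
theorem closure_three_eq_top :
    Subgroup.closure ({SemidirectProduct.inr (Multiplicative.ofAdd 1),
        SemidirectProduct.inl (FreeGroup.of 0) * SemidirectProduct.inr (Multiplicative.ofAdd 1),
        SemidirectProduct.inl (FreeGroup.of 1) * SemidirectProduct.inr (Multiplicative.ofAdd 1)} :
      Set (FreeGroup (Fin 2) ⋊[φ] Multiplicative (ZMod 2))) = ⊤ := by
  set σ : Multiplicative (ZMod 2) := Multiplicative.ofAdd 1 with hσ
  set C := Subgroup.closure ({SemidirectProduct.inr σ,
        SemidirectProduct.inl (FreeGroup.of 0) * SemidirectProduct.inr σ,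
        SemidirectProduct.inl (FreeGroup.of 1) * SemidirectProduct.inr σ} :
      Set (FreeGroup (Fin 2) ⋊[φ] Multiplicative (ZMod 2))) with hC
  have hσC : (SemidirectProduct.inr σ : FreeGroup (Fin 2) ⋊[φ] Multiplicative (ZMod 2)) ∈ C :=
    Subgroup.subset_closure (by simp)
  have hof : ∀ a : Fin 2, (SemidirectProduct.inl (FreeGroup.of a) : FreeGroup (Fin 2) ⋊[φ] Multiplicative (ZMod 2)) ∈ C := by
    intro a
    have ha : (SemidirectProduct.inl (FreeGroup.of a) * SemidirectProduct.inr σ :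
        FreeGroup (Fin 2) ⋊[φ] Multiplicative (ZMod 2)) ∈ C := by
      refine Subgroup.subset_closure ?_
      fin_cases a <;> simp
    have := C.mul_mem ha (C.inv_mem hσC)
    simpa using this
  have hinl : ∀ n : FreeGroup (Fin 2), (SemidirectProduct.inl n : FreeGroup (Fin 2) ⋊[φ] Multiplicative (ZMod 2)) ∈ C := by
    intro n
    have hn : n ∈ Subgroup.closure (Set.range (FreeGroup.of : Fin 2 → FreeGroup (Fin 2))) := by
      rw [FreeGroup.closure_range_of]; trivial
    have hmap : (Subgroup.closure (Set.range (FreeGroup.of : Fin 2 → FreeGroup (Fin 2)))).map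
        (SemidirectProduct.inl : FreeGroup (Fin 2) →* FreeGroup (Fin 2) ⋊[φ] Multiplicative (ZMod 2)) ≤ C := by
      rw [MonoidHom.map_closure, Subgroup.closure_le]
      rintro _ ⟨_, ⟨a, rfl⟩, rfl⟩
      exact hof a
    exact hmap ⟨n, hn, rfl⟩
  have hinr : ∀ g : Multiplicative (ZMod 2), (SemidirectProduct.inr g : FreeGroup (Fin 2) ⋊[φ] Multiplicative (ZMod 2)) ∈ C := by
    have hcases : ∀ g : Multiplicative (ZMod 2), g = 1 ∨ g = Multiplicative.ofAdd 1 := by decide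
    intro g
    rcases hcases g with rfl | rfl
    · simp
    · exact hσC
  rw [eq_top_iff]
  intro w _
  rw [← SemidirectProduct.inl_left_mul_inr_right w]
  exact C.mul_mem (hinl _) (hinr _)

/-- **The three generators are involutions** when `φ` is the inversion action: `σ² = 1` and
`(x·σ)² = x·x⁻¹ = 1` for a free letter `x`. [cite: Mochizuki2012, IUTchI §1 p.37] -/
theorem isOfFinOrder_three (hφ : ∀ a : Fin 2, φ (Multiplicative.ofAdd 1) (FreeGroup.of a) = (FreeGroup.of a)⁻¹) :
    ∀ s ∈ ({SemidirectProduct.inr (Multiplicative.ofAdd 1),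
        SemidirectProduct.inl (FreeGroup.of 0) * SemidirectProduct.inr (Multiplicative.ofAdd 1),
        SemidirectProduct.inl (FreeGroup.of 1) * SemidirectProduct.inr (Multiplicative.ofAdd 1)} :
      Set (FreeGroup (Fin 2) ⋊[φ] Multiplicative (ZMod 2))), IsOfFinOrder s := by
  have h11 : Multiplicative.ofAdd (1 : ZMod 2) * Multiplicative.ofAdd (1 : ZMod 2) = 1 := by decide
  have hsq : ∀ a : Fin 2, (SemidirectProduct.inl (FreeGroup.of a) * SemidirectProduct.inr (Multiplicative.ofAdd 1) :
      FreeGroup (Fin 2) ⋊[φ] Multiplicative (ZMod 2)) ^ 2 = 1 := by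
    intro a
    rw [pow_two]
    ext
    · simp [hφ a]
    · simp [h11]
  have hσ : (SemidirectProduct.inr (Multiplicative.ofAdd 1) : FreeGroup (Fin 2) ⋊[φ] Multiplicative (ZMod 2)) ^ 2 = 1 := by
    rw [pow_two, ← map_mul, h11, map_one]
  intro s hs
  simp only [Set.mem_insert_iff, Set.mem_singleton_iff] at hs
  rcases hs with rfl | rfl | rfl
  · exact isOfFinOrder_iff_pow_eq_one.mpr ⟨2, two_pos, hσ⟩
  · exact isOfFinOrder_iff_pow_eq_one.mpr ⟨2, two_pos, hsq 0⟩
  · exact isOfFinOrder_iff_pow_eq_one.mpr ⟨2, two_pos, hsq 1⟩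

end Orbifold

/-! ### §3. The profinite datum and its geometric origin record -/

/-- Over an algebraically closed field the absolute Galois group is trivial. [folklore] -/
private theorem subsingleton_absoluteGaloisGroup_model (k : Type) [Field k] [IsAlgClosed k] :
    Subsingleton (Field.absoluteGaloisGroup k) := by
  refine ⟨fun σ τ => AlgEquiv.ext fun x => ?_⟩
  obtain ⟨a, rfl⟩ :=
    (IsAlgClosed.algebraMap_bijective_of_isIntegral (k := k) (K := AlgebraicClosure k)).2 x
  rw [AlgEquiv.commutes, AlgEquiv.commutes]

/-- For an extension whose Galois group is trivial, `Δ = Π`. [folklore] -/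
private theorem geom_eq_top_of_subsingleton_model (E : FundamentalExtension.{0}) [Subsingleton E.gal] :
    E.geom = ⊤ := by
  rw [eq_top_iff]
  intro x _
  rw [FundamentalExtension.mem_geom]
  exact Subsingleton.elim _ _

end GeomOriginProfiniteModel

open GeomOriginProfiniteModel Literature.AnabelianGeometry.AbsoluteAnabelian
  Literature.IUT.HodgeTheaters.ProfiniteCompletion in
/-- **The geometric ORIGIN RECORD of [IUTchI] §1 is INHABITED at an explicit PROFINITE datum** (L5 row R47
«GEOMORIGIN-NV@PROFINITE»; the profinite half of the Cor. 1.2 non-vacuity pair).  THE DATUM `D₀`: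
`Π_C := Ŵ`, the profinite completion of the orbifold group `W = F₂ ⋊ ℤ/2` of the `(1,1)_±` orbicurve
(`F₂ = ⟨a, b⟩` the topological `π₁` of a once-punctured torus, `ℤ/2` acting by the elliptic involution
`a ↦ a⁻¹`, `b ↦ b⁻¹`; `W` is generated by the three involutions `σ, aσ, bσ`, i.e. it is the `(2,2,2,∞)`
orbifold group `ℤ/2 ∗ ℤ/2 ∗ ℤ/2`), over an algebraically closed base (`G_k := Gal(ℚ̄/ℚ̄) = 1`, so
`Π_C = Δ_C`); `Π_X := Ker(Ŵ ↠ W/F₂ ≅ ℤ/2)` (open of index `2`, `= Δ_X`), `Π_C̲ := Π_C`, `l := 5`,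
assumption (∗) holds because `G_k = 1`; four cusp labels `ε⁰, ε′, ε″, 2ε` all carrying the
decomposition = inertia group `⟨η[a, b]⟩⁻` of the zero cusp (representatives of the one conjugacy class of
cusps of `X`).  THE RECORD `O₀ : D₀.GeomOrigin`: `gens = (η a, η b)`; (A) `Δ_X = Π_X` is FREE PROFINITE on
them — the corestriction `F₂ → Π_X` of `η` is a pro-`𝔓𝔯𝔦𝔪𝔢𝔰` completion (`isProSigmaCompletion_codRestrict`:
`Ŵ`-density meets the open kernel; finite quotients through `Ŵ ↠ W/core_W(N)`) and abc-iut-L4-t15's bridge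
`isFreeProOn_of_isProSigmaCompletion_lift` (p424814) applies; (c′) with `g = 1`; (e) `Δ_C = Ŵ` is the
closure of `η(W)` and `W` is generated by involutions.  HONEST LABEL: a group-theoretic model (profinite
completion of a topological orbifold fundamental group), not the étale `π₁` of a `k`-scheme — none is
constructed in the tree; it shows the record type `GeomOrigin` is consistent with the interface
`PuncturedEllipticData` at a datum whose `Δ_X` is genuinely `F̂₂` (the pro-`l` half, abc-iut-L5-d4's
COR12-NV-PROL, has `IsFreeProOn` false by design).  Nothing here bears on [IUTchIII] Cor. 3.12; inhabited ≠
endorsed; no side taken. [cite: Mochizuki2012, IUTchI §1 p.37] [cite: MochizukiAbsTopI2012, Lemma 4.5 (i) p.54] -/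
theorem PuncturedEllipticData.exists_nonempty_geomOrigin :
    ∃ D : PuncturedEllipticData.{0}, Nonempty D.GeomOrigin ∧ Subsingleton D.E.gal ∧ D.PiX.index = 2 ∧
      Nonempty (D.PiC ≃ₜ* profiniteCompletion
        (FreeGroup (Fin 2) ⋊[Classical.choose exists_inversionAction] Multiplicative (ZMod 2))) := by
  classical
  -- the inversion action and the orbifold group `W`
  set φ := Classical.choose exists_inversionAction with hφdef
  have hφ : ∀ a : Fin 2, φ (Multiplicative.ofAdd 1) (FreeGroup.of a) = (FreeGroup.of a)⁻¹ :=
    Classical.choose_spec exists_inversionAction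
  haveI hnormal := normal_range_inl φ
  have hindex := index_range_inl φ
  haveI hfi : (SemidirectProduct.inl : FreeGroup (Fin 2) →*
      FreeGroup (Fin 2) ⋊[φ] Multiplicative (ZMod 2)).range.FiniteIndex := ⟨by rw [hindex]; norm_num⟩
  -- the open index-2 subgroup `Π_X = Ker(Ŵ ↠ ℤ/2)`
  obtain ⟨K, hKo, hKi, hK⟩ := exists_open_subgroup_of_finiteIndex
    (W := FreeGroup (Fin 2) ⋊[φ] Multiplicative (ZMod 2)) SemidirectProduct.inl.range
  have hKc : IsClosed (K : Set (profiniteCompletion (FreeGroup (Fin 2) ⋊[φ] Multiplicative (ZMod 2)))) :=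
    K.isClosed_of_isOpen hKo
  -- the extension `Π_C ↠ G_k` with `G_k = Gal(ℚ̄/ℚ̄) = 1`
  haveI : Subsingleton (Field.absoluteGaloisGroup (AlgebraicClosure ℚ)) :=
    subsingleton_absoluteGaloisGroup_model _
  let E : FundamentalExtension.{0} :=
    { arith := profiniteCompletion (FreeGroup (Fin 2) ⋊[φ] Multiplicative (ZMod 2))
      gal := absoluteGaloisGrp (AlgebraicClosure ℚ)
      aug := 1
      aug_surjective := fun _ => ⟨1, Subsingleton.elim _ _⟩ }
  have hEgeom : E.geom = ⊤ := geom_eq_top_of_subsingleton_model E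
  have hKg : K ⊓ E.geom = K := by rw [hEgeom, inf_top_eq]
  -- the corestriction `j : F₂ → Π_X ∩ Δ_C = Π_X`
  have hmem : ∀ x : FreeGroup (Fin 2),
      (toCompletion (FreeGroup (Fin 2) ⋊[φ] Multiplicative (ZMod 2))).comp SemidirectProduct.inl x ∈ K ⊓ E.geom := by
    intro x
    rw [hKg]
    exact (hK _).2 ⟨x, rfl⟩
  have hKo' : IsOpen ((K ⊓ E.geom : Subgroup _) : Set (profiniteCompletion (FreeGroup (Fin 2) ⋊[φ] Multiplicative (ZMod 2)))) := by
    rw [hKg]; exact hKo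
  have hK' : ∀ w : FreeGroup (Fin 2) ⋊[φ] Multiplicative (ZMod 2),
      toCompletion _ w ∈ K ⊓ E.geom ↔ w ∈ (SemidirectProduct.inl : FreeGroup (Fin 2) →* _).range := by
    intro w; rw [hKg]; exact hK w
  let j : FreeGroup (Fin 2) →* ↥(K ⊓ E.geom) :=
    ((toCompletion (FreeGroup (Fin 2) ⋊[φ] Multiplicative (ZMod 2))).comp SemidirectProduct.inl).codRestrict
      (K ⊓ E.geom) hmem
  have hfree : IsFreeProOn ↥(K ⊓ E.geom) Set.univ (fun a : Fin 2 => j (FreeGroup.of a)) :=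
    isFreeProOn_univ_of_prime
      (isFreeProOn_codRestrict SemidirectProduct.inl SemidirectProduct.inl_injective (K ⊓ E.geom) hKo' hK' hmem)
  -- the cusp inertia `⟨η[a,b]⟩⁻`
  let c : profiniteCompletion (FreeGroup (Fin 2) ⋊[φ] Multiplicative (ZMod 2)) :=
    (j (FreeGroup.of 0) : profiniteCompletion (FreeGroup (Fin 2) ⋊[φ] Multiplicative (ZMod 2))) *
      (j (FreeGroup.of 1)) * (j (FreeGroup.of 0))⁻¹ * (j (FreeGroup.of 1))⁻¹
  have hcK : c ∈ K := by
    have h0 : (j (FreeGroup.of 0) : profiniteCompletion (FreeGroup (Fin 2) ⋊[φ] Multiplicative (ZMod 2))) ∈ K :=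
      (hmem (FreeGroup.of 0)).1
    have h1 : (j (FreeGroup.of 1) : profiniteCompletion (FreeGroup (Fin 2) ⋊[φ] Multiplicative (ZMod 2))) ∈ K :=
      (hmem (FreeGroup.of 1)).1
    exact K.mul_mem (K.mul_mem (K.mul_mem h0 h1) (K.inv_mem h0)) (K.inv_mem h1)
  have hIle : (Subgroup.zpowers c).topologicalClosure ≤ K :=
    Subgroup.topologicalClosure_minimal _ ((Subgroup.zpowers_le).mpr hcK) hKc
  -- the datum
  let D : PuncturedEllipticData.{0} :=
    { l := 5
      five_le := le_rfl
      coprime_six := by decide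
      E := E
      PiX := K
      PiCbar := ⊤
      isOpen_piX := hKo
      isOpen_piCbar := isOpen_univ
      index_piX := by rw [hKi, hindex]
      aug_piX := fun _ => ⟨1, Subsingleton.elim _ _⟩
      aug_piCbar := fun _ => ⟨1, Subsingleton.elim _ _⟩
      star := by
        intro g hg x hx
        have hg' : g ∈ K ⊓ E.geom := by rw [hKg]; exact hg
        exact Subgroup.le_topologicalClosure _
          (Subgroup.mem_sup_left (Subgroup.commutator_mem_commutator hg' hx))
      Cusp := Fin 4
      decomp := fun _ => (Subgroup.zpowers c).topologicalClosure
      decomp_le := fun _ => le_inf hIle le_top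
      ε0 := 0
      ε1 := 1
      ε2 := 2
      twoε := 3
      ε1_ne_ε0 := by decide
      ε2_ne_ε0 := by decide
      ε1_ne_ε2 := by decide
      twoε_ne := by decide
      aug_decomp_twoε := fun _ => ⟨1, Subsingleton.elim _ _⟩ }
  have hDgeom : D.DeltaC = ⊤ := hEgeom
  -- the record
  refine ⟨D, ⟨⟨fun a => j (FreeGroup.of a), hfree, ?_, ?_⟩⟩, ‹_›, ?_, ⟨ContinuousMulEquiv.refl _⟩⟩
  · -- (c′): every cusp inertia is `⟨[a,b]⟩⁻` itself (`g = 1`)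
    intro x
    refine ⟨1, Subgroup.one_mem _, ?_⟩
    change (Subgroup.zpowers c).topologicalClosure ⊓ E.geom = (Subgroup.zpowers (1 * c * 1⁻¹)).topologicalClosure
    rw [one_mul, inv_one, mul_one]
    have hle : (Subgroup.zpowers c).topologicalClosure ≤ E.geom := by rw [hEgeom]; exact le_top
    exact inf_eq_left.mpr hle
  · -- (e): `Δ_C = Ŵ` is topologically generated by torsion: `η(W)` is dense and `W = ⟨σ, aσ, bσ⟩`
    rw [hDgeom]
    intro y _
    have hd : DenseRange (toCompletion (FreeGroup (Fin 2) ⋊[φ] Multiplicative (ZMod 2))) :=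
      ProfiniteGrp.ProfiniteCompletion.denseRange (GrpCat.of _)
    have hy : y ∈ closure (Set.range (toCompletion (FreeGroup (Fin 2) ⋊[φ] Multiplicative (ZMod 2)))) := by
      rw [hd.closure_range]; trivial
    refine (Subgroup.isClosed_topologicalClosure _).closure_subset_iff.mpr ?_ hy
    rintro _ ⟨w, rfl⟩
    have hw : w ∈ Subgroup.closure ({SemidirectProduct.inr (Multiplicative.ofAdd 1),
        SemidirectProduct.inl (FreeGroup.of 0) * SemidirectProduct.inr (Multiplicative.ofAdd 1),
        SemidirectProduct.inl (FreeGroup.of 1) * SemidirectProduct.inr (Multiplicative.ofAdd 1)} :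
      Set (FreeGroup (Fin 2) ⋊[φ] Multiplicative (ZMod 2))) := by
      rw [closure_three_eq_top]; trivial
    refine Subgroup.le_topologicalClosure _ ?_
    have hmap := Subgroup.mem_map_of_mem (toCompletion (FreeGroup (Fin 2) ⋊[φ] Multiplicative (ZMod 2))) hw
    rw [MonoidHom.map_closure] at hmap
    refine Subgroup.closure_mono ?_ hmap
    rintro _ ⟨s, hs, rfl⟩
    refine ⟨Subgroup.mem_top _, ?_⟩
    exact (toCompletion _).isOfFinOrder (isOfFinOrder_three φ hφ s hs)
  · -- `[Π_C : Π_X] = 2`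
    change K.index = 2
    rw [hKi, hindex]

/-- **Cusp rationality (r) at the profinite datum** (v2 append, on abc-iut-L5-t1's note 05:19:56Z: the
hypothesis `hrat` of `PuncturedEllipticData.inertia_central_of_star_freePro` / `GeomOrigin.inertia_central_of_rational`,
p500241): at a datum carrying a geometric origin record there is moreover one at which EVERY cusp decomposition
group surjects onto `G_k` — at `D₀` trivially, `G_k = Gal(ℚ̄/ℚ̄)` being a point; together with `Subsingleton D.E.gal`
and `[Π_C : Π_X] = 2`. [cite: Mochizuki2012, IUTchI §1 p.37] -/
theorem PuncturedEllipticData.exists_nonempty_geomOrigin_rational :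
    ∃ D : PuncturedEllipticData.{0}, Nonempty D.GeomOrigin ∧
      (∀ x : D.Cusp, Function.Surjective (D.E.aug.toMonoidHom.comp (D.decomp x).subtype)) ∧
      Subsingleton D.E.gal ∧ D.PiX.index = 2 := by
  obtain ⟨D, hO, hsub, hidx, -⟩ := PuncturedEllipticData.exists_nonempty_geomOrigin
  haveI := hsub
  exact ⟨D, hO, fun x y => ⟨1, Subsingleton.elim _ _⟩, hsub, hidx⟩

end Literature.IUT.HodgeTheaters

end
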